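import Summits.QuantumFields.YangMills.Theorems.BalabanUVNodesK0AxTangentSocketOntoSmallRadii
import HarnessLib

/-!
# NODE N07 → K0ᴬ — PROP. 6's `RegimeTok` AT THE FLAT SCHEME OF RECORD «IN THE SMALL», MODULO PROP. 4 FOR `W` ONLY: at `U₀ = 1` the current vanishes (`J(1) = 0`, ✓`JOfRecordAtBg_one`), the shift
# `𝔄(V) = H₁B(V)` is continuous at `V = 1` with `𝔄(1) = 0` (✓`analyticAt_frakAOfRecordAtBg128C`, ✓`frakAOfRecordAtBg128_self`), and `𝔊(1)` is a bounded operator (`B₀ := ‖𝔊‖`); so for the data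
# `j := 0`, `ε₄ = a := t` small and the (7)-domain `dom := {V | ‖𝔄(V)‖ < t}` (a neighbourhood of `1`), def-Y's ✓`bgSchemeOfRecord_regimeTok_of` needs ONLY (R2) = Prop. 4's `QuadAnalytic W C₄ a₃`
# ([15] Prop. 6 (117)–(121) p. 295, (28) p. 282, (103) p. 293, Prop. 4 (98) p. 293)

Cell `pub-ymgap`, width seat `pub-ymgap-dag-n07-w3` (g27), CLAIM-14.  `--kind proof --supports stmt-QuantumFields-27238 --as helper`; count-neutral.
[15] = [Balaban1985Variational]; [B9] = [Balaban1985BackgroundPropagators].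

CONTENTS (any `N`, flat background `U₀ = 1`, level `k`).
* §1 `continuousAt_frakAOfRecordAtBg128_one`, `frakAOfRecordAtBg128_one`, ★`frakADom_mem_nhds_one` (`{V | ‖𝔄 V‖ < t} ∈ 𝓝 1` for `t > 0`).
* §2 ★★★`regimeTok_flat_ofRecord_small` — given (R2) `QuadAnalytic (WOfRecordAt … 1 …) C₄ a₃` (`0 ≤ C₄`, `0 < a₃`): `∃ t > 0`, `4t ≤ a₃`, with `dom := {V | ‖𝔄 V‖ < t} ∈ 𝓝 1` and
  `(bgSchemeOfRecord F N K k Ω 1 dom levB G′ Δ2 a hposπ hpos♭ hQ ε_C ‖𝔊‖ C₄ a₃ 0 t t).RegimeTok`.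

HONEST LABELS.  EXISTENTIAL, NON-UNIFORM constants (`B₀ = ‖𝔊(1)‖` at one lattice, not [B9] Thm 3.13's uniform `B₀`; `t` unquantified); (R2) — Bałaban's Prop. 4 for `W = (δ∕δA′)V` — stays
DISPLAYED (lit ✓`quadAnalytic_W80` reduces it to the `V₀`-group bound and the kernel-column letters (73), (46)); flat background only.  Count-neutral; N07 NOT discharged; K0ᴬ NOT closed; P0 ⟨26900⟩
OPEN; R4 is the conditional finite-𝕋⁴ rung only.  Nothing here is a claim about the Yang–Mills mass gap (`Summit.QuantumFields`): finite torus, fixed `ε`; nothing continuum ∕ OS ∕ Clay.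
-/

set_option autoImplicit false

noncomputable section

open Filter Metric Topology
open scoped Matrix Matrix.Norms.L2Operator InnerProductSpace ComplexConjugate

namespace Summit.QuantumFields.YangMills.Theorems.N07RegimeTokFlatOfRecordSmall

open Literature.MathematicalPhysics.QuantumFieldTheory.Balaban1983to89
open Literature.MathematicalPhysics.QuantumFieldTheory.Balaban1983to89.T4Continuum (T4Family)
open T4Continuum BlockAveraging
open B11Eq103H1Complex (SiteL2K BondL2K)
open B11Eq174Chart (Regime)
open B13Contraction113 (QuadAnalytic)
open Node00

section Flat

variable (F : T4Family) (N : ℕ) [NeZero N] (K : ℕ) (k : ℕ) (Ω : ℕ → Set (Site (F.P K) 0))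
  [Fact (0 < (F.L : ℝ))] [Fact (0 < (F.P K).eta k)] [Fact (0 < c0Rec F K k)] [Fact (∀ c, 0 < wBRec F K k c)]
  (levB : PBond (F.P K) k → ℕ)
  {Gp : SiteL2K ℂ (F.P K).d (fun _ => (F.P K).sitesPerDir 0) (c0Rec F K k) (WRec N) →ₗ[ℂ]
    SiteL2K ℂ (F.P K).d (fun _ => (F.P K).sitesPerDir 0) (c0Rec F K k) (WRec N)}
  {Δ2 : BondL2K ℂ (F.P K).d (fun _ => (F.P K).sitesPerDir 0) (c0Rec F K k) (WRec N) →ₗ[ℂ]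
    BondL2K ℂ (F.P K).d (fun _ => (F.P K).sitesPerDir 0) (c0Rec F K k) (WRec N)} (a : ℝ)
  (hposπ : ∀ x, x ≠ 0 → 0 < RCLike.re ⟪x, laplaceAOfRecordAt F N k (1 : GaugeField (F.P K) 0 (SU N))
    (hessOpOfRecord128 F N k (1 : GaugeField (F.P K) 0 (SU N)) Gp (QflatOfRecord F N k) Δ2)
    (QOfRecord F N k (1 : GaugeField (F.P K) 0 (SU N))) (QflatOfRecord F N k) a x⟫_ℂ)
  (hposb : ∀ x, x ≠ 0 → 0 < RCLike.re ⟪x, laplaceAOfRecord F N k (1 : GaugeField (F.P K) 0 (SU N))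
    (QOfRecord F N k (1 : GaugeField (F.P K) 0 (SU N))) (QflatOfRecord F N k) a x⟫_ℂ)
  (hQ : Function.Surjective (QOfRecord F N k (1 : GaugeField (F.P K) 0 (SU N))))

/-! ## §1  The shift `𝔄` near the unit configuration -/

/-- **`𝔄(1) = 0`** at the flat background (`Ū^k(1) = 1`, ✓`frakAOfRecordAtBg128_self`). [cite: Balaban1985Variational, (20) p.281, (103) p.293] -/
theorem frakAOfRecordAtBg128_one :
    frakAOfRecordAtBg128 F N K k Ω (1 : GaugeField (F.P K) 0 (SU N)) levB Gp Δ2 a hposπ hQ (1 : GaugeField (F.P K) k (SU N)) = 0 := by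
  have h := frakAOfRecordAtBg128_self F N K k Ω (1 : GaugeField (F.P K) 0 (SU N)) levB Gp Δ2 a hposπ hQ
  rwa [avOfRecord_iter_one] at h

/-- **`V ↦ 𝔄(V)` IS CONTINUOUS AT `V = 1`** (the complex-datum edition `𝔄ᶜ` is analytic on the log-polydisc, ✓`analyticAt_frakAOfRecordAtBg128C`, and `𝔄 = 𝔄ᶜ ∘ coeField`).
[cite: Balaban1985Variational, (103) p.293, Sect. G p.307] -/
theorem continuousAt_frakAOfRecordAtBg128_one :
    ContinuousAt (fun V : GaugeField (F.P K) k (SU N) => frakAOfRecordAtBg128 F N K k Ω (1 : GaugeField (F.P K) 0 (SU N)) levB Gp Δ2 a hposπ hQ V) 1 := by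
  have hlog : ∀ c : PBond (F.P K) k, ‖coeField (1 : GaugeField (F.P K) k (SU N)) c *
      star (Averaging.iter (avOfRecord F N K) k (1 : GaugeField (F.P K) 0 (SU N)) c : Matrix (Fin N) (Fin N) ℂ) - 1‖ < 1 := fun c => by
    rw [avOfRecord_iter_one, coeField_apply, show (1 : GaugeField (F.P K) k (SU N)) c = 1 from rfl, OneMemClass.coe_one, star_one, mul_one, sub_self, norm_zero]
    exact one_pos
  have han := analyticAt_frakAOfRecordAtBg128C F N K k Ω (1 : GaugeField (F.P K) 0 (SU N)) levB Gp Δ2 a hposπ hQ hlog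
  have hcoe : Continuous (fun V : GaugeField (F.P K) k (SU N) => coeField V) :=
    continuous_pi fun b => continuous_subtype_val.comp (continuous_apply b)
  have h := han.continuousAt.comp (hcoe.continuousAt (x := (1 : GaugeField (F.P K) k (SU N))))
  simpa only [Function.comp_def, frakAOfRecordAtBg128C_coeField] using h

/-- ★ **THE (7)-DOMAIN IN THE SMALL IS A NEIGHBOURHOOD OF `1`**: `{V | ‖𝔄(V)‖ < t} ∈ 𝓝 1` for every `t > 0`. [cite: Balaban1985Variational, (7) p.278, (103) p.293] -/
theorem frakADom_mem_nhds_one {t : ℝ} (ht : 0 < t) :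
    {V : GaugeField (F.P K) k (SU N) | ‖frakAOfRecordAtBg128 F N K k Ω (1 : GaugeField (F.P K) 0 (SU N)) levB Gp Δ2 a hposπ hQ V‖ < t} ∈
      𝓝 (1 : GaugeField (F.P K) k (SU N)) := by
  have hc := continuousAt_frakAOfRecordAtBg128_one F N K k Ω levB a hposπ hQ (Gp := Gp) (Δ2 := Δ2)
  have h0 : frakAOfRecordAtBg128 F N K k Ω (1 : GaugeField (F.P K) 0 (SU N)) levB Gp Δ2 a hposπ hQ (1 : GaugeField (F.P K) k (SU N)) ∈
      ball (0 : Space115Lit F N K k Ω (1 : GaugeField (F.P K) 0 (SU N))) t := by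
    rw [frakAOfRecordAtBg128_one, mem_ball, dist_self]; exact ht
  have h := hc.preimage_mem_nhds (isOpen_ball.mem_nhds h0)
  refine Filter.mem_of_superset h fun V hV => ?_
  have hV' : ‖frakAOfRecordAtBg128 F N K k Ω (1 : GaugeField (F.P K) 0 (SU N)) levB Gp Δ2 a hposπ hQ V‖ < t := by
    simpa only [Set.mem_preimage, mem_ball, dist_zero_right] using hV
  exact hV'

/-! ## §2  `RegimeTok` at the flat scheme of record, modulo (R2) -/

/-- ★★★ **`RegimeTok` AT THE FLAT SCHEME OF RECORD FROM PROP. 4 ALONE (existential data)**: given (R2) `QuadAnalytic (W(1)) C₄ a₃` with `0 ≤ C₄`, `0 < a₃`, there is `t > 0` with `4t ≤ a₃` such that for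
`dom := {V | ‖𝔄 V‖ < t}` (a neighbourhood of `1`), `B₀ := ‖𝔊(1)‖`, `j := 0`, `a := ε₄ := t`, the scheme of record at `U₀ = 1` satisfies Prop. 6's regime token: (117) by the operator norm, (28)
by `J(1) = 0`, (103) by the choice of `dom`, (118)–(121) by `4t ≤ a₃`, `8B₀C₄t < 1`. [cite: Balaban1985Variational, Prop. 6 (117)–(121) p.295, (28) p.282, (103) p.293, Prop. 4 (98) p.293] -/
theorem regimeTok_flat_ofRecord_small (εC : ℝ) {C₄ a₃ : ℝ} (hC₄ : 0 ≤ C₄) (ha₃ : 0 < a₃)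
    (hW : QuadAnalytic (WOfRecordAt F N K k Ω (1 : GaugeField (F.P K) 0 (SU N)) levB a hposb hQ εC Gp) C₄ a₃) :
    ∃ t : ℝ, 0 < t ∧ 4 * t ≤ a₃ ∧
      {V : GaugeField (F.P K) k (SU N) | ‖frakAOfRecordAtBg128 F N K k Ω (1 : GaugeField (F.P K) 0 (SU N)) levB Gp Δ2 a hposπ hQ V‖ < t} ∈
        𝓝 (1 : GaugeField (F.P K) k (SU N)) ∧
      (bgSchemeOfRecord F N K k Ω (1 : GaugeField (F.P K) 0 (SU N))
        {V : GaugeField (F.P K) k (SU N) | ‖frakAOfRecordAtBg128 F N K k Ω (1 : GaugeField (F.P K) 0 (SU N)) levB Gp Δ2 a hposπ hQ V‖ < t}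
        levB Gp Δ2 a hposπ hposb hQ εC ‖frakGOfRecordAtBg128 F N K k Ω (1 : GaugeField (F.P K) 0 (SU N)) Gp Δ2 a hposπ hQ‖ C₄ a₃ 0 t t).RegimeTok := by
  set B₀ : ℝ := ‖frakGOfRecordAtBg128 F N K k Ω (1 : GaugeField (F.P K) 0 (SU N)) Gp Δ2 a hposπ hQ‖ with hB₀
  have hB₀0 : 0 ≤ B₀ := by rw [hB₀]; exact norm_nonneg (frakGOfRecordAtBg128 F N K k Ω (1 : GaugeField (F.P K) 0 (SU N)) Gp Δ2 a hposπ hQ)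
  have hBC : 0 ≤ B₀ * C₄ := mul_nonneg hB₀0 hC₄
  set t : ℝ := min (a₃ / 4) (1 / (8 * (B₀ * C₄) + 1)) with ht
  have hden : 0 < 8 * (B₀ * C₄) + 1 := by positivity
  have htpos : 0 < t := lt_min (by positivity) (by positivity)
  have h4 : 4 * t ≤ a₃ := by
    have := min_le_left (a₃ / 4) (1 / (8 * (B₀ * C₄) + 1))
    linarith
  have h8 : 8 * (B₀ * C₄) * t < 1 := by
    have h1 : t ≤ 1 / (8 * (B₀ * C₄) + 1) := min_le_right _ _
    have h2 : 8 * (B₀ * C₄) * t ≤ 8 * (B₀ * C₄) * (1 / (8 * (B₀ * C₄) + 1)) := mul_le_mul_of_nonneg_left h1 (by positivity)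
    have h3 : 8 * (B₀ * C₄) * (1 / (8 * (B₀ * C₄) + 1)) < 1 := by
      rw [mul_one_div, div_lt_one hden]
      linarith
    exact h2.trans_lt h3
  refine ⟨t, htpos, h4, frakADom_mem_nhds_one F N K k Ω levB a hposπ hQ htpos, fun V hV => ⟨?_, ?_, ?_⟩⟩
  · -- Prop. 6's regime for the data at `1`
    exact
      { norm_G := fun f => (frakGOfRecordAtBg128 F N K k Ω (1 : GaugeField (F.P K) 0 (SU N)) Gp Δ2 a hposπ hQ).le_opNorm f
        norm_L := fun Y => by simp
        quad := hW
        B₀_nonneg := hB₀0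
        C₄_nonneg := hC₄
        θ_nonneg := le_rfl
        ε₄_nonneg := htpos.le
        dom := by show 2 * (t + t) ≤ a₃; linarith
        self := by
          show B₀ * 0 + 0 * (t + t) + B₀ * C₄ * (t + t) ^ 2 ≤ t
          have h1 : B₀ * C₄ * (t + t) ^ 2 = (4 * (B₀ * C₄) * t) * t := by ring
          have h2 : 4 * (B₀ * C₄) * t ≤ 1 := by nlinarith
          nlinarith [mul_le_mul_of_nonneg_right h2 htpos.le]
        contr := by
          show (0 : ℝ) + 4 * B₀ * C₄ * (t + t) < 1
          nlinarith }
  · -- (28): `J(1) = 0`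
    show ‖JOfRecordAtBg F N K k Ω (1 : GaugeField (F.P K) 0 (SU N))‖ ≤ 0
    rw [JOfRecordAtBg_one, norm_zero]
  · -- (103): the domain
    exact hV

end Flat

end Summit.QuantumFields.YangMills.Theorems.N07RegimeTokFlatOfRecordSmall

end
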